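import Summits.BirchSwinnertonDyer.BirchSwinnertonDyer.Theorems.GoldfeldAllTwistsTwoConverseTwinQuarterTraceRedeiPOne
import HarnessLib

set_option linter.dupNamespace false -- namespace `…BirchSwinnertonDyer.BirchSwinnertonDyer…` is the cell's (D-0017 nested layout)
set_option autoImplicit false

/-!
# OBJECT A7⁺, TRANCHE T1, file R⁺: the Rédei bit of the two-prime family at `(p/q) = +1` —
# `RM(−qp) = 0`, `r₄(ℚ(√−qp)) = 1`, `4 ∣ h(−qp)`, the principal genus `Cl(𝒪_{−qp})²` has EVEN order

Cell `bsd-goldfeld`, seat `bsd-goldfeld-s1p-c3x` (gen 15); planner RULING (ccclxxxii) ORDER «OBJECT A7⁺ BY THE χ_Z CHANNEL», tranche T1,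
file R⁺ (memo `HOME/PLUS-CHIZ-CHANNEL.md`). `--supports stmt-BirchSwinnertonDyer-20044` as a HELPER (nothing is closed). Theses-free; theorems
only; no definition, no `sorry`, no new fact (the Rédei–Reichardt theorem is the tree's PROVED `redeiReichardt_fourTwoCard_classGroup_holds`).

WHY. In the landed quarter-point chain of the α cells C4/C7A (`(p/q) = −1`) the ONE class-group input of the χ_e package is file R's
`not_four_dvd_natCard_classGroup_QO_negTwoPrimes` (`h4e`: `4 ∤ h(−qp)`, i.e. `#Cl(F)²` ODD for the partner field `F = ℚ(√−qp)`), consumed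
as `hκodd` in `exists_partnerField_data*` through the GENERIC half-trace law `halfTrace_add_map_conj_eq_negTwoPrimes`
(`Φ + τΦ = (#Cl(𝒪_{−qp})²) • T`). On the `(p/q) = +1` cells the Rédei matrix `RM(−qp)` on `(q, p)` is the ZERO matrix
(`(p/q) = (−q/p) = +1`), so `#(Cl_F² ∩ Cl_F[2]) = 2` (`r₄ = 1`), `4 ∣ h(−qp)` and `#Cl(𝒪_{−qp})²` is EVEN — the half-trace law reads
`Φ + τΦ = O` there. This file proves exactly these four statements (p, q mod 8 free), the `(p/q) = +1` twins of file R §3: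
* (group theory `#G[2] = 2^a`, `#(G² ∩ G[2]) = 2` ⟹ `2^{a+1} ∣ #G` is `pow_succ_dvd_natCard_of_fourTwoCard_eq_two` of file `…QuarterTraceRedeiPOne`,
  imported BY NAME.)
* §1 `redeiMatrix_negTwoPrimes_plus` (`RM(−qp) = 0`), `card_ker_redeiMatrix_negTwoPrimes_plus` (kernel `4`),
  `fourTwoCard_eq_two_negTwoPrimes_plus` (`r₄ = 1` for every quadratic `F ∋ √−qp`), `four_dvd_natCard_classGroup_QO_negTwoPrimes_plus`
  (`4 ∣ #Cl(𝒪_{−qp})` on the tree's abstract-order carrier, bridge = Cox Thm. 7.7 (ii) on both carriers as in file R),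
  `even_natCard_range_sq_classGroup_QO_negTwoPrimes_plus` (`Even #Cl(𝒪_{−qp})²`, with `[Cl : Cl²] = 2` from
  `index_range_sq_classGroup_QO_eq_two_negTwoPrimes`).
HONEST FRAMING: a class-group lemma for a twist-density-ZERO two-parameter cell; nothing about BSD; items 19140 / 19350 / 20044 untouched;
BSD is not proved by any of this.
References: [LiMa2008] Lemma 0.1, Def. 0.2, Thm. 0.4; [RedeiReichardt1934]; [Stevenhagen1995RedeiMatrices] §2; [Cox2013] §3.A Prop. 3.11,
§3.B Thm. 3.15, §7.B Thm. 7.7 (ii); [IrelandRosen1990] Ch. 5 §2 (reciprocity).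
-/

noncomputable section

open Matrix NumberField
open Literature.NumberTheory Literature.NumberTheory.EllipticCurves
open Literature.NumberTheory.EllipticCurves.Tian2014 (IsQuadraticFieldOfSqrt fourTwoCard fourTwoCard_def)
open Literature.NumberTheory.QuadraticFields.RedeiReichardt
open Literature.NumberTheory.EllipticCurves.LiLiuTian2024.RedeiFamilies (natCast_ne_zero_of_prime_ne kroneckerBit_eq_zero_iff_jacobiSym)
open Literature.NumberTheory.ComplexMultiplication (CMTypeLattice.natCard_classGroup_QO_of_emod_four)
open Literature.Computability.Cryptography.Hallgren2005

namespace Summit.BirchSwinnertonDyer.BirchSwinnertonDyer.Theorems.GoldfeldGoodTwists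

/-! ## §1 Rédei–Reichardt at `D = −qp` with `(p/q) = +1`: `RM = 0`, `r₄ = 1` (the group-theory step `pow_succ_dvd_natCard_of_fourTwoCard_eq_two` is file `…RedeiPOne`'s) -/
section TwoPrimesPlus
variable {q p : ℕ}

/-- **`RM(−qp) = 0`** on the tuple `(q, p)` when `(p/q) = +1`: `(D_p/q) = (p/q) = +1` and `(D_q/p) = (−q/p) = (p/q) = +1`
(`p ≡ 1 (mod 4)`, reciprocity). [cite: LiMa2008, Def. 0.2 and Thm. 0.4 (pp. 279–280); evaluation ours] -/
theorem redeiMatrix_negTwoPrimes_plus (hq : q.Prime) (hp : p.Prime) (hq4 : q % 4 = 3) (hp4 : p % 4 = 1)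
    (hpq : jacobiSym (p : ℤ) q = 1) : redeiMatrix (q * p) ![q, p] = 0 := by
  have dq : primeDisc (q * p) q = -(q : ℤ) := by rw [primeDisc_of_ne_two _ (by omega), if_neg (by omega)]
  have dp : primeDisc (q * p) p = p := by rw [primeDisc_of_ne_two _ (by omega), if_pos hp4]
  have hne : q ≠ p := by omega
  have hqp : jacobiSym (-(q : ℤ)) p = 1 := by
    rw [jacobiSym.neg _ (Nat.odd_iff.mpr (by omega)), ZMod.χ₄_nat_one_mod_four hp4, one_mul,
      ← jacobiSym.quadratic_reciprocity_one_mod_four hp4 (Nat.odd_iff.mpr (by omega))]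
    exact hpq
  have e01 : kroneckerBit (p : ℤ) q = 0 :=
    (kroneckerBit_eq_zero_iff_jacobiSym hq (by omega) (natCast_ne_zero_of_prime_ne hq hp hne.symm)).mpr hpq
  have e10 : kroneckerBit (-(q : ℤ)) p = 0 := by
    refine (kroneckerBit_eq_zero_iff_jacobiSym hp (by omega) ?_).mpr hqp
    rw [Int.cast_neg, neg_ne_zero]
    exact natCast_ne_zero_of_prime_ne hp hq hne
  ext i j
  fin_cases i <;> fin_cases j <;>
    simp [redeiMatrix, Finset.sum_erase_eq_sub, Fin.sum_univ_two, dq, dp, e01, e10]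

/-- Kernel count `4` (`rank RM = 0`, `r₄ = 1`) for `D = −qp`, `(p/q) = +1`. [cite: LiMa2008, Thm. 0.4 (p. 280)] -/
theorem card_ker_redeiMatrix_negTwoPrimes_plus (hq : q.Prime) (hp : p.Prime) (hq4 : q % 4 = 3) (hp4 : p % 4 = 1)
    (hpq : jacobiSym (p : ℤ) q = 1) :
    Fintype.card {v : Fin 2 → ZMod 2 // redeiMatrix (q * p) ![q, p] *ᵥ v = 0} = 4 := by
  have hM := redeiMatrix_negTwoPrimes_plus hq hp hq4 hp4 hpq
  rw [Fintype.card_congr (Equiv.subtypeEquivRight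
    (q := fun v : Fin 2 → ZMod 2 => (0 : Matrix (Fin 2) (Fin 2) (ZMod 2)) *ᵥ v = 0)
    (fun v => by rw [hM]))]
  decide

/-- **`(p/q) = +1 ⟹ #(Cl² ∩ Cl[2]) = 2` for every quadratic `F ∋ √−qp`** (`r₄ = 1`), from the tree's PROVED Rédei–Reichardt theorem.
[cite: LiMa2008, Thm. 0.4 (p. 280); evaluation ours] -/
theorem fourTwoCard_eq_two_negTwoPrimes_plus (hq : q.Prime) (hp : p.Prime) (hq4 : q % 4 = 3) (hp4 : p % 4 = 1)
    (hpq : jacobiSym (p : ℤ) q = 1) (F : Type) [Field F] [NumberField F]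
    (hF : IsQuadraticFieldOfSqrt F (-((q * p : ℕ) : ℤ))) : fourTwoCard (ClassGroup (𝓞 F)) = 2 := by
  obtain ⟨hpr, hinj, hprod⟩ := redei_side_conditions_negTwoPrimes hq hp hq4 hp4
  exact fourTwoCard_eq_two_of_card_ker' hpr hinj hprod (card_ker_redeiMatrix_negTwoPrimes_plus hq hp hq4 hp4 hpq) F hF

/-- **`(p/q) = +1 ⟹ 4 ∣ #Cl(𝒪_{−qp})`** on the tree's abstract-order carrier (`q ≡ 3 (mod 4)`, `p ≡ 1 (mod 4)` primes): the bridge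
`#Cl(𝒪_D) = #Cl(𝓞_F)` (Cox Thm. 7.7 (ii) on both carriers), Gauss `#Cl_F[2] = 2`, and `r₄ = 1` (Rédei–Reichardt).
[cite: LiMa2008, Thm. 0.4 (p. 280)] [cite: Cox2013, §3.A Prop. 3.11 and §7.B Thm. 7.7 (ii)] -/
theorem four_dvd_natCard_classGroup_QO_negTwoPrimes_plus (hq : q.Prime) (hp : p.Prime) (hq4 : q % 4 = 3) (hp4 : p % 4 = 1)
    (hpq : jacobiSym (p : ℤ) q = 1) (Δ : OrderCl.NegDiscr) (hΔ : Δ.D = -((q : ℤ) * p)) :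
    4 ∣ Nat.card (ClassGroup (OrderCl.QO Δ)) := by
  classical
  set n : ℕ := q * p with hn_def
  have hne : q ≠ p := by omega
  have hn4 : n % 4 = 3 := by rw [hn_def, Nat.mul_mod, hq4, hp4]
  have hnZ : (-((q : ℤ) * p)) = -(n : ℤ) := by rw [hn_def]; push_cast; ring
  have hsqf : Squarefree n := (Nat.squarefree_mul ((Nat.coprime_primes hq hp).mpr hne)).mpr ⟨hq.squarefree, hp.squarefree⟩
  have hsqfZ : Squarefree (-(n : ℤ)) := (Int.squarefree_natCast.mpr hsqf).squarefree_of_dvd ⟨-1, by ring⟩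
  obtain ⟨F, _, _, h2, hdF⟩ := QuadraticFields.Quadratic.exists_numberField_discr_eq (D := -(n : ℤ))
    (Or.inl ⟨by omega, hsqfZ, by omega⟩)
  have hFq : IsImaginaryQuadratic F := isImaginaryQuadratic_iff_discr_neg.mpr ⟨h2, by rw [hdF]; have := hq.pos; omega⟩
  have hD4 : Δ.D % 4 = 0 ∨ Δ.D % 4 = 1 := Or.inr (by rw [hΔ, hnZ]; omega)
  have hbridge : Nat.card (ClassGroup (OrderCl.QO Δ)) = Nat.card (ClassGroup (𝓞 F)) := by
    rw [CMTypeLattice.natCard_classGroup_QO_of_emod_four Δ hD4, hΔ, hnZ, ← hdF,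
      QuadraticFields.Quadratic.card_reducedForms_eq_classNumber h2 hFq.discr_neg, NumberField.classNumber,
      ← Nat.card_eq_fintype_card]
  rw [hbridge]
  have h2tor : Nat.card {c : ClassGroup (𝓞 F) // c ^ 2 = 1} = 2 ^ 1 := by
    rw [natCard_sq_eq_one_classGroup_of_primeFactors hFq (S := {q, p}) ?_]
    · rw [Finset.card_insert_of_notMem (by simp [hne]), Finset.card_singleton]
    · rw [hdF, Int.natAbs_neg, Int.natAbs_natCast, hn_def, Nat.primeFactors_mul hq.ne_zero hp.ne_zero, hq.primeFactors,
        hp.primeFactors]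
      rfl
  have h := pow_succ_dvd_natCard_of_fourTwoCard_eq_two h2tor
    (fourTwoCard_eq_two_negTwoPrimes_plus hq hp hq4 hp4 hpq F (hdF ▸ isQuadraticFieldOfSqrt_discr hFq))
  rwa [show (2 : ℕ) ^ (1 + 1) = 4 by norm_num] at h

/-- **`(p/q) = +1 ⟹ #Cl(𝒪_{−qp})²` is EVEN** (the principal genus of `ℚ(√−qp)`; `[Cl : Cl²] = 2` by Gauss, `4 ∣ h` by `r₄ = 1`) — the
sign flip of the half-trace law `Φ + τΦ = (#Cl²) • T` over the partner field `F = ℚ(√−qp)` between the `(p/q) = −1` cells (odd, `= T`)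
and the `(p/q) = +1` cells (even, `= O`). [cite: LiMa2008, Thm. 0.4 (p. 280)] [cite: Cox2013, §3.B Thm. 3.15] -/
theorem even_natCard_range_sq_classGroup_QO_negTwoPrimes_plus (hq : q.Prime) (hp : p.Prime) (hq4 : q % 4 = 3)
    (hp4 : p % 4 = 1) (hpq : jacobiSym (p : ℤ) q = 1) (Δ : OrderCl.NegDiscr) (hΔ : Δ.D = -((q : ℤ) * p))
    [Finite (ClassGroup (OrderCl.QO Δ))] :
    Even (Nat.card (powMonoidHom 2 : ClassGroup (OrderCl.QO Δ) →* ClassGroup (OrderCl.QO Δ)).range) := by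
  have hne : q ≠ p := by omega
  have hidx := index_range_sq_classGroup_QO_eq_two_negTwoPrimes Δ hq hp (by omega) (by omega) hne hΔ
    (by rw [hΔ]; have h4 : ((q : ℤ) * p) % 4 = 3 := by
          have : (q * p) % 4 = 3 := by rw [Nat.mul_mod, hq4, hp4]
          exact_mod_cast this
        omega)
  obtain ⟨k, hk⟩ := four_dvd_natCard_classGroup_QO_negTwoPrimes_plus hq hp hq4 hp4 hpq Δ hΔ
  have hmul := Subgroup.card_mul_index (powMonoidHom 2 : ClassGroup (OrderCl.QO Δ) →* ClassGroup (OrderCl.QO Δ)).range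
  rw [hidx, hk] at hmul
  exact ⟨k, by omega⟩

end TwoPrimesPlus

end Summit.BirchSwinnertonDyer.BirchSwinnertonDyer.Theorems.GoldfeldGoodTwists

end
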